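import Literature.Analysis.SpecialFunctions.AssociatedLegendreHilbertBasis
import HarnessLib

/-!
# Derivative and lowering identities for the monic orthogonal polynomials of the weights
# `(1 - x²)^m`, and their three-term recurrence in `m`

Topic `Literature/Analysis/SpecialFunctions`; continues `AssociatedLegendreHilbertBasis.lean`
(`q_{m,k} = assocLegPoly m k`, monic of degree `k`, orthogonal for
`B_m(p,q) = ∫_{-1}^1 p q (1-x²)^m`).
The classical Gegenbauer relations (`C_k^{(λ)'} = 2λ C_{k-1}^{(λ+1)}`, the lowering
`((1-x²)^{λ+1/2} C^{(λ+1)}_{k-1})' ∝ (1-x²)^{λ-1/2} C^{(λ)}_k`; AAR (6.4.15), (6.4.19)) proved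
**abstractly** — integration by parts plus the uniqueness of monic orthogonal polynomials
(`assocLegPoly_eq_of_orthogonal`):

* `derivative_assocLegPoly` (D1): `q'_{m,k+1} = (k+1) q_{m+1,k}`;
* `assocLegPoly_lowering` (D2): `(1-x²) q'_{m+1,k} - 2(m+1) x q_{m+1,k} = -(2m+k+2) q_{m,k+1}`;
* `assocLegPoly_m_rec`: **the recurrence in `m` at fixed level `m+k`**,
  `2(m+1) x q_{m+1,k+1} = (k+1)(1-x²) q_{m+2,k} + (2m+k+3) q_{m,k+2}`.

These give the angular-derivative structure of the associated Legendre functions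
`(1-x²)^{m/2} q_{m,k}` used for the smoothness of expansions in oblate spheroidal harmonics
(Dafermos–Rodnianski–Shlapentokh-Rothman, arXiv:1402.7034, §5.2.1).

## References

* G. E. Andrews, R. Askey, R. Roy, *Special Functions* (1999), (6.4.15), (6.4.19).
  [AndrewsAskeyRoy1999]
* M. Dafermos, I. Rodnianski, Y. Shlapentokh-Rothman, arXiv:1402.7034, §5.2.1.
  [DafermosRodnianskiShlapentokhrothman2014]
-/

noncomputable section

open Finset Polynomial MeasureTheory Set intervalIntegral

namespace Literature.Analysis.SpecialFunctions

/-! ### Uniqueness of the monic orthogonal polynomials -/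

/-- **Uniqueness**: a monic polynomial of degree `k` which is `B_m`-orthogonal to all polynomials of
degree `< k` is `q_{m,k}`. [folklore] -/
theorem assocLegPoly_eq_of_orthogonal (m k : ℕ) {R : ℝ[X]} (hR : R.Monic) (hdeg : R.natDegree = k)
    (horth : ∀ p : ℝ[X], p.natDegree < k → assocLegForm m R p = 0) : R = assocLegPoly m k := by
  rcases Nat.eq_zero_or_pos k with rfl | hk
  · rw [assocLegPoly_zero]
    rw [Polynomial.Monic, Polynomial.leadingCoeff, hdeg] at hR
    rw [eq_C_of_natDegree_le_zero hdeg.le, hR, map_one]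
  set D := R - assocLegPoly m k with hD
  have hDdeg : D.natDegree < k := by
    have h1 : D.degree < k := by
      rw [hD]
      have hRd : R.degree = k := by rw [degree_eq_natDegree hR.ne_zero, hdeg]
      have hQd : (assocLegPoly m k).degree = k := by
        rw [degree_eq_natDegree (assocLegPoly_ne_zero m k), natDegree_assocLegPoly]
      refine (degree_sub_lt (hRd.trans hQd.symm) hR.ne_zero ?_).trans_eq hRd
      rw [hR.leadingCoeff, (monic_assocLegPoly m k).leadingCoeff]
    by_cases hD0 : D = 0
    · rw [hD0, natDegree_zero]; exact hk
    · exact (natDegree_lt_iff_degree_lt hD0).2 h1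
  have hself : assocLegForm m D D = 0 := by
    have h1 : assocLegForm m R D = 0 := horth D hDdeg
    have h2 : assocLegForm m (assocLegPoly m k) D = 0 :=
      assocLegForm_assocLegPoly_of_natDegree_lt m hDdeg
    have h3 : assocLegForm m D D = assocLegForm m R D - assocLegForm m (assocLegPoly m k) D := by
      rw [hD, assocLegForm_sub_left]
    rw [h3, h1, h2, sub_zero]
  by_contra hne
  have hD0 : D ≠ 0 := fun h ↦ hne (sub_eq_zero.1 h)
  exact (assocLegForm_self_pos m hD0).ne' hself

/-! ### The weights -/

/-- `(1-x²)^{m+1} = (1-x²)^m (1-x²)`. [folklore] -/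
theorem assocLegWeight_succ (m : ℕ) : assocLegWeight (m + 1) = assocLegWeight m * (1 - X ^ 2) := by
  rw [assocLegWeight, assocLegWeight, pow_succ]

/-- `(1-x²)^{m+1}` vanishes at `1`. [folklore] -/
theorem eval_one_assocLegWeight_succ (m : ℕ) : (assocLegWeight (m + 1)).eval 1 = 0 := by
  simp [assocLegWeight]

/-- `(1-x²)^{m+1}` vanishes at `-1`. [folklore] -/
theorem eval_neg_one_assocLegWeight_succ (m : ℕ) : (assocLegWeight (m + 1)).eval (-1) = 0 := by
  simp [assocLegWeight]

/-- `((1-x²)^{m+1})' = -2(m+1) x (1-x²)^m`. [folklore] -/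
theorem derivative_assocLegWeight_succ (m : ℕ) :
    derivative (assocLegWeight (m + 1)) = C (-(2 * ((m : ℝ) + 1))) * X * assocLegWeight m := by
  rw [assocLegWeight, assocLegWeight, derivative_pow, derivative_sub, derivative_one,
    derivative_X_pow, zero_sub, Nat.add_sub_cancel]
  simp only [Nat.cast_add, Nat.cast_one, Nat.cast_ofNat]
  rw [show C (-(2 * ((m : ℝ) + 1))) = -(C (2 : ℝ) * C ((m : ℝ) + 1)) by
    rw [← C_mul, ← map_neg]]
  ring

/-- **Integration by parts against the weight `(1-x²)^{m+1}`**: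
`∫ f' g (1-x²)^{m+1} = -∫ f (g (1-x²)^{m+1})'` (no boundary terms). [folklore] -/
theorem integral_derivative_mul_weight_succ (m : ℕ) (f g : ℝ[X]) :
    ∫ x in (-1 : ℝ)..1, (derivative f).eval x * (g * assocLegWeight (m + 1)).eval x =
      -∫ x in (-1 : ℝ)..1, f.eval x * (derivative (g * assocLegWeight (m + 1))).eval x := by
  rw [integral_derivative_mul f (g * assocLegWeight (m + 1))]
  simp [eval_mul, eval_one_assocLegWeight_succ, eval_neg_one_assocLegWeight_succ]

/-- The derivative of `g (1-x²)^{m+1}` is `(g'(1-x²) - 2(m+1) x g) (1-x²)^m`. [folklore] -/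
theorem derivative_mul_weight_succ (m : ℕ) (g : ℝ[X]) :
    derivative (g * assocLegWeight (m + 1)) =
      (derivative g * (1 - X ^ 2) - C (2 * ((m : ℝ) + 1)) * X * g) * assocLegWeight m := by
  rw [derivative_mul, derivative_assocLegWeight_succ, assocLegWeight_succ]
  simp only [map_neg, neg_mul]
  ring

/-! ### (D1) The derivative identity -/

/-- Orthogonality of `q'_{m,k+1}` for the weight `(1-x²)^{m+1}`. [folklore] -/
theorem assocLegForm_derivative_assocLegPoly (m k : ℕ) {p : ℝ[X]} (hp : p.natDegree < k) :
    assocLegForm (m + 1) (derivative (assocLegPoly m (k + 1))) p = 0 := by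
  rw [assocLegForm_eq_integral]
  have h1 : ∀ x, (derivative (assocLegPoly m (k + 1))).eval x * p.eval x *
      (assocLegWeight (m + 1)).eval x =
      (derivative (assocLegPoly m (k + 1))).eval x * (p * assocLegWeight (m + 1)).eval x := by
    intro x; rw [eval_mul]; ring
  simp_rw [h1]
  rw [integral_derivative_mul_weight_succ, derivative_mul_weight_succ, neg_eq_zero]
  have h2 : ∀ x, (assocLegPoly m (k + 1)).eval x *
      ((derivative p * (1 - X ^ 2) - C (2 * ((m : ℝ) + 1)) * X * p) * assocLegWeight m).eval x =
      (assocLegPoly m (k + 1)).eval x *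
        (derivative p * (1 - X ^ 2) - C (2 * ((m : ℝ) + 1)) * X * p).eval x *
        (assocLegWeight m).eval x := by
    intro x; rw [eval_mul]; ring
  simp_rw [h2]
  rw [← assocLegForm_eq_integral]
  refine assocLegForm_assocLegPoly_of_natDegree_lt m ?_
  -- degree of the test polynomial is `≤ deg p + 1 < k + 1`
  have hX2 : (1 - X ^ 2 : ℝ[X]).natDegree ≤ 2 := by
    refine (natDegree_sub_le _ _).trans ?_
    rw [natDegree_one, natDegree_X_pow]; simp
  have hd1 : (derivative p * (1 - X ^ 2)).natDegree ≤ p.natDegree + 1 := by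
    by_cases hp0 : derivative p = 0
    · rw [hp0, zero_mul, natDegree_zero]; omega
    have hpos : 0 < p.natDegree := by
      by_contra h0
      have h00 : p.natDegree = 0 := by omega
      exact hp0 (derivative_of_natDegree_zero h00)
    calc (derivative p * (1 - X ^ 2)).natDegree
        ≤ (derivative p).natDegree + (1 - X ^ 2 : ℝ[X]).natDegree := natDegree_mul_le
      _ ≤ (p.natDegree - 1) + 2 := add_le_add (natDegree_derivative_le p) hX2
      _ ≤ p.natDegree + 1 := by omega
  have hd2 : (C (2 * ((m : ℝ) + 1)) * X * p).natDegree ≤ p.natDegree + 1 := by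
    calc (C (2 * ((m : ℝ) + 1)) * X * p).natDegree
        ≤ (C (2 * ((m : ℝ) + 1)) * X).natDegree + p.natDegree := natDegree_mul_le
      _ ≤ 1 + p.natDegree := add_le_add ((natDegree_C_mul_le _ _).trans natDegree_X_le) le_rfl
      _ = p.natDegree + 1 := add_comm _ _
  calc (derivative p * (1 - X ^ 2) - C (2 * ((m : ℝ) + 1)) * X * p).natDegree
      ≤ max (derivative p * (1 - X ^ 2)).natDegree (C (2 * ((m : ℝ) + 1)) * X * p).natDegree :=
        natDegree_sub_le _ _
    _ ≤ p.natDegree + 1 := max_le hd1 hd2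
    _ < k + 1 := by omega

/-- **(D1) `q'_{m,k+1} = (k+1) q_{m+1,k}`.** [cite: AndrewsAskeyRoy1999, (6.4.15)] -/
theorem derivative_assocLegPoly (m k : ℕ) :
    derivative (assocLegPoly m (k + 1)) = C ((k : ℝ) + 1) * assocLegPoly (m + 1) k := by
  have hk : ((k : ℝ) + 1) ≠ 0 := by positivity
  -- the normalised derivative is monic of degree `k` and orthogonal
  set R := C ((k : ℝ) + 1)⁻¹ * derivative (assocLegPoly m (k + 1)) with hR
  have hlead : (derivative (assocLegPoly m (k + 1))).leadingCoeff = (k : ℝ) + 1 ∧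
      (derivative (assocLegPoly m (k + 1))).natDegree = k := by
    have hmon := monic_assocLegPoly m (k + 1)
    have hnd := natDegree_assocLegPoly m (k + 1)
    have h1 : (assocLegPoly m (k + 1)).coeff (k + 1) = 1 := by
      have := hmon.coeff_natDegree; rwa [hnd] at this
    have hcoeff : (derivative (assocLegPoly m (k + 1))).coeff k = (k : ℝ) + 1 := by
      rw [coeff_derivative, h1, one_mul]
    have hdeg_le : (derivative (assocLegPoly m (k + 1))).natDegree ≤ k := by
      have := natDegree_derivative_le (assocLegPoly m (k + 1))
      rw [hnd] at this
      simpa using this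
    have hdeg : (derivative (assocLegPoly m (k + 1))).natDegree = k := by
      refine le_antisymm hdeg_le ?_
      refine le_natDegree_of_ne_zero ?_
      rw [hcoeff]; exact hk
    refine ⟨?_, hdeg⟩
    rw [leadingCoeff, hdeg, hcoeff]
  have hRmonic : R.Monic := by
    rw [Monic, hR, leadingCoeff_mul, leadingCoeff_C, hlead.1, inv_mul_cancel₀ hk]
  have hRdeg : R.natDegree = k := by
    rw [hR, natDegree_mul' (by rw [leadingCoeff_C, hlead.1]; exact mul_ne_zero (inv_ne_zero hk) hk),
      natDegree_C, zero_add, hlead.2]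
  have hRorth : ∀ p : ℝ[X], p.natDegree < k → assocLegForm (m + 1) R p = 0 := fun p hp ↦ by
    rw [hR, assocLegForm_C_mul_left, assocLegForm_derivative_assocLegPoly m k hp, mul_zero]
  have hReq := assocLegPoly_eq_of_orthogonal (m + 1) k hRmonic hRdeg hRorth
  rw [← hReq, hR, ← mul_assoc, ← C_mul, mul_inv_cancel₀ hk, C_1, one_mul]

/-! ### (D2) The lowering identity -/

/-- Orthogonality of `(1-x²) q'_{m+1,k} - 2(m+1) x q_{m+1,k}` for the weight `(1-x²)^m`.
[folklore] -/
theorem assocLegForm_lowering (m k : ℕ) {p : ℝ[X]} (hp : p.natDegree < k + 1) :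
    assocLegForm m (derivative (assocLegPoly (m + 1) k) * (1 - X ^ 2) -
      C (2 * ((m : ℝ) + 1)) * X * assocLegPoly (m + 1) k) p = 0 := by
  -- `∫ [(q (1-x²)^{m+1})'] p = -∫ q (1-x²)^{m+1} p'`
  rw [assocLegForm_eq_integral]
  have h1 : ∀ x, (derivative (assocLegPoly (m + 1) k) * (1 - X ^ 2) -
      C (2 * ((m : ℝ) + 1)) * X * assocLegPoly (m + 1) k).eval x * p.eval x *
        (assocLegWeight m).eval x =
      (derivative (assocLegPoly (m + 1) k * assocLegWeight (m + 1))).eval x * p.eval x := by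
    intro x
    rw [derivative_mul_weight_succ, eval_mul]
    ring
  simp_rw [h1]
  rw [integral_derivative_mul]
  simp only [eval_mul, eval_one_assocLegWeight_succ, eval_neg_one_assocLegWeight_succ, mul_zero,
    zero_mul, sub_zero, zero_sub, neg_eq_zero]
  have h2 : ∀ x, (assocLegPoly (m + 1) k).eval x * (assocLegWeight (m + 1)).eval x *
      (derivative p).eval x =
      (assocLegPoly (m + 1) k).eval x * (derivative p).eval x *
        (assocLegWeight (m + 1)).eval x := by
    intro x; ring
  simp_rw [h2]
  rw [← assocLegForm_eq_integral]
  by_cases hp0 : p.natDegree = 0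
  · rw [derivative_of_natDegree_zero hp0]
    simp [assocLegForm]
  · refine assocLegForm_assocLegPoly_of_natDegree_lt (m + 1) ?_
    calc (derivative p).natDegree ≤ p.natDegree - 1 := natDegree_derivative_le p
      _ < k := by omega

/-- **(D2) The lowering identity**
`(1-x²) q'_{m+1,k} - 2(m+1) x q_{m+1,k} = -(2m+k+2) q_{m,k+1}`.
[cite: AndrewsAskeyRoy1999, (6.4.19)] -/
theorem assocLegPoly_lowering (m k : ℕ) :
    derivative (assocLegPoly (m + 1) k) * (1 - X ^ 2) -
        C (2 * ((m : ℝ) + 1)) * X * assocLegPoly (m + 1) k =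
      C (-(2 * (m : ℝ) + k + 2)) * assocLegPoly m (k + 1) := by
  set S := derivative (assocLegPoly (m + 1) k) * (1 - X ^ 2) -
    C (2 * ((m : ℝ) + 1)) * X * assocLegPoly (m + 1) k with hS
  have hc : (-(2 * (m : ℝ) + k + 2)) ≠ 0 := by
    have : (0 : ℝ) < 2 * m + k + 2 := by positivity
    linarith
  -- degree and leading coefficient of `S`
  have hq := monic_assocLegPoly (m + 1) k
  have hqd := natDegree_assocLegPoly (m + 1) k
  have hSdeg_le : S.natDegree ≤ k + 1 := by
    have h1 : (derivative (assocLegPoly (m + 1) k) * (1 - X ^ 2)).natDegree ≤ k + 1 := by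
      by_cases h0 : derivative (assocLegPoly (m + 1) k) = 0
      · rw [h0, zero_mul, natDegree_zero]; omega
      have hk : 0 < k := by
        by_contra hk0
        have hk0' : k = 0 := by omega
        subst hk0'
        exact h0 (by rw [assocLegPoly_zero, derivative_one])
      calc _ ≤ (derivative (assocLegPoly (m + 1) k)).natDegree + (1 - X ^ 2 : ℝ[X]).natDegree :=
            natDegree_mul_le
        _ ≤ (k - 1) + 2 := by
            refine add_le_add ?_ ?_
            · have := natDegree_derivative_le (assocLegPoly (m + 1) k); rwa [hqd] at this
            · refine (natDegree_sub_le _ _).trans ?_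
              rw [natDegree_one, natDegree_X_pow]; simp
        _ ≤ k + 1 := by omega
    have h2 : (C (2 * ((m : ℝ) + 1)) * X * assocLegPoly (m + 1) k).natDegree ≤ k + 1 := by
      calc _ ≤ (C (2 * ((m : ℝ) + 1)) * X).natDegree + (assocLegPoly (m + 1) k).natDegree :=
            natDegree_mul_le
        _ ≤ 1 + k := add_le_add ((natDegree_C_mul_le _ _).trans natDegree_X_le) hqd.le
        _ = k + 1 := add_comm _ _
    exact (natDegree_sub_le _ _).trans (max_le h1 h2)
  have hqk : (assocLegPoly (m + 1) k).coeff k = 1 := by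
    have := hq.coeff_natDegree; rwa [hqd] at this
  have hScoeff : S.coeff (k + 1) = -(2 * (m : ℝ) + k + 2) := by
    rw [hS, coeff_sub]
    -- first term: `(q' (1 - X²)).coeff (k+1) = -(q'.coeff (k-1)) = -k`
    have h0 : (derivative (assocLegPoly (m + 1) k)).coeff (k + 1) = 0 := by
      refine coeff_eq_zero_of_natDegree_lt ?_
      calc (derivative (assocLegPoly (m + 1) k)).natDegree ≤ k - 1 := by
            have := natDegree_derivative_le (assocLegPoly (m + 1) k); rwa [hqd] at this
        _ < k + 1 := by omega
    have hA : (derivative (assocLegPoly (m + 1) k) * (1 - X ^ 2)).coeff (k + 1) = -(k : ℝ) := by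
      rw [mul_sub, mul_one, coeff_sub, h0, zero_sub, coeff_mul_X_pow']
      rcases Nat.eq_zero_or_pos k with rfl | hk
      · simp
      · rw [if_pos (by omega), coeff_derivative, show k + 1 - 2 + 1 = k by omega, hqk, one_mul]
        have : ((k + 1 - 2 : ℕ) : ℝ) + 1 = k := by
          rw [show k + 1 - 2 = k - 1 by omega, Nat.cast_sub hk]; push_cast; ring
        rw [this]
    have hB : (C (2 * ((m : ℝ) + 1)) * X * assocLegPoly (m + 1) k).coeff (k + 1) =
        2 * ((m : ℝ) + 1) := by
      rw [mul_assoc, coeff_C_mul, mul_comm X, coeff_mul_X, hqk, mul_one]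
    rw [hA, hB]
    ring
  have hSdeg : S.natDegree = k + 1 := by
    refine le_antisymm hSdeg_le (le_natDegree_of_ne_zero ?_)
    rw [hScoeff]; exact hc
  have hSlead : S.leadingCoeff = -(2 * (m : ℝ) + k + 2) := by rw [leadingCoeff, hSdeg, hScoeff]
  -- normalise and apply uniqueness
  set R := C (-(2 * (m : ℝ) + k + 2))⁻¹ * S with hR
  have hRmonic : R.Monic := by
    rw [Monic, hR, leadingCoeff_mul, leadingCoeff_C, hSlead, inv_mul_cancel₀ hc]
  have hRdeg : R.natDegree = k + 1 := by
    rw [hR, natDegree_mul' (by rw [leadingCoeff_C, hSlead]; exact mul_ne_zero (inv_ne_zero hc) hc),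
      natDegree_C, zero_add, hSdeg]
  have hRorth : ∀ p : ℝ[X], p.natDegree < k + 1 → assocLegForm m R p = 0 := fun p hp ↦ by
    rw [hR, assocLegForm_C_mul_left, assocLegForm_lowering m k hp, mul_zero]
  have hReq := assocLegPoly_eq_of_orthogonal m (k + 1) hRmonic hRdeg hRorth
  rw [← hReq, hR, ← mul_assoc, ← C_mul, mul_inv_cancel₀ hc, C_1, one_mul]

/-! ### The recurrence in `m` -/

/-- **Three-term recurrence in `m` at fixed level `m + k + 2`**:
`2(m+1) x q_{m+1,k+1} = (k+1) (1-x²) q_{m+2,k} + (2m+k+3) q_{m,k+2}`.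
[cite: AndrewsAskeyRoy1999, §6.4] -/
theorem assocLegPoly_m_rec (m k : ℕ) :
    C (2 * ((m : ℝ) + 1)) * X * assocLegPoly (m + 1) (k + 1) =
      C ((k : ℝ) + 1) * (1 - X ^ 2) * assocLegPoly (m + 2) k +
        C (2 * (m : ℝ) + k + 3) * assocLegPoly m (k + 2) := by
  have h2 := assocLegPoly_lowering m (k + 1)
  rw [derivative_assocLegPoly (m + 1) k,
    show (-(2 * (m : ℝ) + ((k + 1 : ℕ) : ℝ) + 2)) = -(2 * (m : ℝ) + k + 3) by push_cast; ring,
    map_neg] at h2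
  -- `h2 : ((k+1) q_{m+2,k}) (1-X²) - 2(m+1) X q_{m+1,k+1} = -(2m+k+3) q_{m,k+2}`
  linear_combination -h2

end Literature.Analysis.SpecialFunctions
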